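import Summits.FinalStateConjecture.FinalStateConjecture.Theorems.ExactKerrEndsTameEscapeToKerrEndsGluingCurve
import HarnessLib

/-!
# Route `ExactKerrEnds`, crux `CensorshipAlongKerrEnds` (stmt-FinalStateConjecture-18521), line `Sketch` v4
# (compact-support architecture): stub `stub_radialOfCurve` — CURVE-indexed ⟹ RADIUS-indexed receding gluing

The sibling crux E's analytic atom S1♭ (hypothesis 1 of the landed
`Theorems.ExactKerrEnds.tameEscapeToKerrEnds_of_matchedKerrGluingCurve_of_nonposMassKerrEnded`) delivers, for an
admissible datum `d` with sole DR end `e` of mass parameter `M > 0`, a CURVE `s ↦ G s` (`s > s⋆`) of admissible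
Kerr-ended glued data, jointly smooth in `(s, x)`, equal to `d` off `e.far (ρ s)` for a gluing radius `ρ s → ∞`
about which nothing else is known (no monotonicity, continuity or smoothness), DR-flat on `e` with continuous masses
`m s → M`, and `e.wDist (G s) d → 0`.  The far patch of the v4 architecture (`stub_patchAlongCompactFamily`) wants
the same family RADIUS-indexed: the member at parameter `R > R⋆ > e.R` agrees with `d` off `e.far R`.

This file is that conversion, pure bookkeeping: choose a `C^∞` reparametrisation `τ` of the parameter with
`s⋆ < τ t`, `t < ρ (τ t)` and `t ≤ τ t` (`exists_contDiff_reparam_of_tendsto_atTop`), and take `R⋆ := e.R + 1`,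
`m ∘ τ`, `G ∘ τ`: joint smoothness is stable under the reparametrisation (`smoothSectionsOn_comp_param`), the member
`G (τ R)` agrees with `d` off `e.far (ρ (τ R)) ⊆ e.far R` (`AFEnd.far_mono`, as `R < ρ (τ R)`), and `τ R → ∞`
transports the two limits.  This is exactly the reparametrisation performed inline in `tameJunction_of_radius`.
Mathlib + the landed cone only; no definitions, no named facts.

References: Christodoulou, CQG 16 (1999) A23, p. A24; Corvino–Schoen, JDG 73 (2006), Thm 4.
-/

-- the summit-side namespace `Summit.FinalStateConjecture.FinalStateConjecture.…` (summit = problem)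
-- doubles the `FinalStateConjecture` path component by design; `dupNamespace` would flag every decl.
set_option linter.dupNamespace false

noncomputable section

open scoped Manifold ContDiff Topology
open Set Filter Function TopologicalSpace Literature.Geometry.Lorentzian
open Summit.FinalStateConjecture.FinalStateConjecture.Theorems.SwallowTheDatum.ParametricKerrBurial
  (SmoothSectionsOn AgreeAt)
open Summit.FinalStateConjecture.FinalStateConjecture.Theorems.ExactKerrEnds
  (exists_contDiff_reparam_of_tendsto_atTop smoothSectionsOn_comp_param)

namespace Summit.FinalStateConjecture.FinalStateConjecture.Theorems.ExactKerrEnds.CensorshipAlongKerrEnds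

/-- **Stub `stub_radialOfCurve` — curve-indexed ⟹ radius-indexed receding gluing at a fixed datum.**  If for every
admissible `d` with sole DR end `e` of mass parameter `M > 0` there is a curve `s ↦ G s` (`s > s⋆`) of admissible
Kerr-ended data, jointly smooth in `(s, x)`, equal to `d` off `e.far (ρ s)` with `ρ s → ∞`, DR-flat on `e` with
continuous masses `m s → M` and `e.wDist (G s) d → 0` (the sibling crux E's atom S1♭), then the same holds
RADIUS-indexed: a threshold `R⋆ > e.R` and a family `R ↦ G' R` (`R > R⋆`), jointly smooth in `(R, x)`, whose member
at `R` agrees with `d` off `e.far R`.  Proof: reparametrise by a smooth `τ` with `s⋆ < τ R`, `R < ρ (τ R)`, `R ≤ τ R`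
(`exists_contDiff_reparam_of_tendsto_atTop`); `G' := G ∘ τ`, `m' := m ∘ τ`, `R⋆ := e.R + 1`; agreement off
`e.far R ⊇ e.far (ρ (τ R))` by `AFEnd.far_mono`. [cite: Christodoulou1999, p. A24] -/
theorem stub_radialOfCurve : (∀ (X : Type) [TopologicalSpace X] [ChartedSpace Literature.Geometry.Lorentzian.E3 X] [IsManifold (𝓡 3) ((⊤ : ℕ∞) : WithTop ℕ∞) X] [T2Space X] [SecondCountableTopology X] [ConnectedSpace X], ∀ [Literature.Geometry.Lorentzian.Kerr.Facts], ∀ d ∈ Literature.Geometry.Lorentzian.admissibleVacuumData X, ∀ (e : Literature.Geometry.Lorentzian.AFEnd X) (M : ℝ), e.IsSoleEnd → 0 < M → e.IsStronglyAsymptoticallyFlatDR d M → ∃ (sstar : ℝ) (ρ m : ℝ → ℝ) (G : ℝ → Literature.Geometry.Lorentzian.InitialDataSet (𝓡 3) X), Filter.Tendsto ρ Filter.atTop Filter.atTop ∧ ContinuousOn m (Set.Ioi sstar) ∧ Filter.Tendsto m Filter.atTop (nhds M) ∧ Summit.FinalStateConjecture.FinalStateConjecture.Theorems.SwallowTheDatum.ParametricKerrBurial.SmoothSectionsOn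 𝓘(ℝ, ℝ) G {p : ℝ × X | sstar < p.1} ∧ (∀ s : ℝ, sstar < s → G s ∈ Literature.Geometry.Lorentzian.admissibleVacuumData X ∧ (∀ x ∉ e.far (ρ s), Summit.FinalStateConjecture.FinalStateConjecture.Theorems.SwallowTheDatum.ParametricKerrBurial.AgreeAt (G s) d x) ∧ e.IsStronglyAsymptoticallyFlatDR (G s) (m s) ∧ (G s).HasExactKerrEnd) ∧ Filter.Tendsto (fun s ↦ e.wDist (G s) d) Filter.atTop (nhds 0)) → ∀ (X : Type) [TopologicalSpace X] [ChartedSpace Literature.Geometry.Lorentzian.E3 X] [IsManifold (𝓡 3) ((⊤ : ℕ∞) : WithTop ℕ∞) X] [T2Space X] [SecondCountableTopology X] [ConnectedSpace X], ∀ [Literature.Geometry.Lorentzian.Kerr.Facts], ∀ d ∈ Literature.Geometry.Lorentzian.admissibleVacuumData X, ∀ (e : Literature.Geometry.Lorentzian.AFEnd X) (M : ℝ), e.IsSoleEnd → 0 < M → e.IsStronglyAsymptoticallyFlatDR d M → ∃ (Rstar : ℝ) (m : ℝ → ℝ) (G : ℝ → Literature.Geometry.Lorentzian.InitialDataSet (𝓡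 3) X), e.R < Rstar ∧ ContinuousOn m (Set.Ioi Rstar) ∧ Filter.Tendsto m Filter.atTop (nhds M) ∧ Summit.FinalStateConjecture.FinalStateConjecture.Theorems.SwallowTheDatum.ParametricKerrBurial.SmoothSectionsOn 𝓘(ℝ, ℝ) G {p : ℝ × X | Rstar < p.1} ∧ (∀ R : ℝ, Rstar < R → G R ∈ Literature.Geometry.Lorentzian.admissibleVacuumData X ∧ (∀ x ∉ e.far R, Summit.FinalStateConjecture.FinalStateConjecture.Theorems.SwallowTheDatum.ParametricKerrBurial.AgreeAt (G R) d x) ∧ e.IsStronglyAsymptoticallyFlatDR (G R) (m R) ∧ (G R).HasExactKerrEnd) ∧ Filter.Tendsto (fun R ↦ e.wDist (G R) d) Filter.atTop (nhds 0) := by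
  intro h1 X _ _ _ _ _ _ _ d hd e M hsole hM hDR
  obtain ⟨sstar, ρ, m, G, hρ, hm, hmM, hG, hmem, hw⟩ := h1 X d hd e M hsole hM hDR
  -- smooth reparametrisation of the parameter: `sstar < τ t`, `t < ρ (τ t)`, `t ≤ τ t`
  obtain ⟨τ, hτ, hτs, hτρ, hτt⟩ := exists_contDiff_reparam_of_tendsto_atTop hρ sstar
  have hτtop : Tendsto τ atTop atTop := tendsto_atTop_mono hτt tendsto_id
  refine ⟨e.R + 1, m ∘ τ, G ∘ τ, lt_add_one _, ?_, hmM.comp hτtop, ?_, ?_, hw.comp hτtop⟩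
  · -- continuity of the reparametrised masses on `(e.R + 1, ∞)`
    exact hm.comp hτ.continuous.continuousOn fun t _ ↦ hτs t
  · -- joint smoothness in `(R, x)` is stable under the smooth reparametrisation
    exact smoothSectionsOn_comp_param hG hτ fun t _ ↦ hτs t
  · -- members: admissible, equal to `d` off `e.far R ⊇ e.far (ρ (τ R))`, DR-flat, Kerr-ended
    intro R _
    obtain ⟨hadm, hagree, hdecay, hkerr⟩ := hmem (τ R) (hτs R)
    exact ⟨hadm, fun x hx ↦ hagree x fun hx' ↦ hx (e.far_mono (hτρ R).le hx'), hdecay, hkerr⟩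

end Summit.FinalStateConjecture.FinalStateConjecture.Theorems.ExactKerrEnds.CensorshipAlongKerrEnds

end
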